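import Summits.ValiantsHypothesis.ValiantsHypothesis.Theorems.DefinabilityGapRounds
import Summits.ValiantsHypothesis.ValiantsHypothesis.Theorems.DefinabilityGapRepick
import Summits.ValiantsHypothesis.ValiantsHypothesis.Theorems.DefinabilityGapMergeCost
import HarnessLib

/-!
# Definability gap, ROAD P: ONE COMPLETE RE-PICK ROUND (PLAN (d) v3, the round invariant)

The pieces of a round — the probabilistic re-pick `DefinabilityGapRepick.exists_repick`, the
deterministic step `DefinabilityGapRounds.round_step` and the clause-2/3 cost
`DefinabilityGapMergeCost.mergeRows_not_mem_phaseABad` — are glued into a single theorem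
**`round_advance`** on the ROUND INVARIANT of an assignment `r`:
(i) admissible (`r c ∈ A c`), (ii) off the Phase-A bad set `phaseABad T M N n₀ p₁ t B`,
(iii) at most `K` movers, (iv) every mover keeps `≥ n` admissible unblocked rows.
One round (re-pick law uniform on `A c ∖ blockedRows`, `p ≥ max(1/m, 1/n)`) produces
`r'' = mergeRows Mv r r'` with: (i); (ii) for `(t + p(2K+1) + t₂, B − p(2K+1) − δ)`;
movers shrink (`⊆`) and number `< K'`; (iv) with `n − p(2K+1) − λ`; non-movers keep their rows —
provided the failure budget `hsmall` of `exists_repick` is `< 1`.  The three-round assembly of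
PLAN (d) v3 is `round_advance` ∘ `round_advance` ∘ `round_advance` from the round-one state
`DefinabilityGapRoundOneAll.exists_roundOneAll`, plus numerics.
-/

namespace Summit.ValiantsHypothesis.ValiantsHypothesis.Theorems.DefinabilityGapRound

open Finset
open Literature.Computability.AlgebraicComplexity Literature.Computability.MetaComplexity
open Summit.ValiantsHypothesis.ValiantsHypothesis.Theorems.DefinabilityGapAffineRung
open Summit.ValiantsHypothesis.ValiantsHypothesis.Theorems.DefinabilityGapPivotCertificate
open Summit.ValiantsHypothesis.ValiantsHypothesis.Theorems.DefinabilityGapPivotAdmissible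
open Summit.ValiantsHypothesis.ValiantsHypothesis.Theorems.DefinabilityGapPivotRandom
open Summit.ValiantsHypothesis.ValiantsHypothesis.Theorems.DefinabilityGapPivotGoodLines
open Summit.ValiantsHypothesis.ValiantsHypothesis.Theorems.DefinabilityGapPivotCrowded
open Summit.ValiantsHypothesis.ValiantsHypothesis.Theorems.DefinabilityGapCrowdedFree
open Summit.ValiantsHypothesis.ValiantsHypothesis.Theorems.DefinabilityGapPivotColumn
open Summit.ValiantsHypothesis.ValiantsHypothesis.Theorems.DefinabilityGapPhaseABad
open Summit.ValiantsHypothesis.ValiantsHypothesis.Theorems.DefinabilityGapMovers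
open Summit.ValiantsHypothesis.ValiantsHypothesis.Theorems.DefinabilityGapAlterationStep
open Summit.ValiantsHypothesis.ValiantsHypothesis.Theorems.DefinabilityGapMergeCost
open Summit.ValiantsHypothesis.ValiantsHypothesis.Theorems.DefinabilityGapRounds
open Summit.ValiantsHypothesis.ValiantsHypothesis.Theorems.DefinabilityGapRepick

variable {m : ℕ}

/-! ## 1. Unrestricted kill weights -/

/-- `rowKillOn univ = rowKill`. [this file] -/
theorem rowKillOn_univ (T : Finset (Fin 3 → Fin (qOf m))) (c : Fin 3 → Fin (qOf m)) (i : Fin m)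
    (c' : Fin 3 → Fin (qOf m)) (a : Fin m) :
    rowKillOn Finset.univ T c i c' a = rowKill T c i c' a := by
  unfold rowKillOn rowKill rowOverlap
  rfl

/-- `colKillOn univ = colKill`. [this file] -/
theorem colKillOn_univ (T : Finset (Fin 3 → Fin (qOf m))) (c : Fin 3 → Fin (qOf m)) (j : Fin m)
    (c' : Fin 3 → Fin (qOf m)) (a : Fin m) :
    colKillOn Finset.univ T c j c' a = colKill T c j c' a := by
  unfold colKillOn colKill
  simp only [Finset.mem_univ, true_and]

/-! ## 2. The room left after a merge -/

open scoped Classical in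
/-- The admissible unblocked rows of `c` after a merge lose at most the rows blocked by the
re-picked movers. [this file] -/
theorem card_room_merge_ge (T Mv : Finset (Fin 3 → Fin (qOf m))) (c : Fin 3 → Fin (qOf m))
    (A : Finset (Fin m)) (r r' : (Fin 3 → Fin (qOf m)) → Fin m) (s₀ : Fin m) :
    (A \ blockedRows T c r s₀).card ≤
      (A \ blockedRows T c (mergeRows Mv r r') s₀).card +
        (blockedRows (T ∩ Mv) c r' s₀).card := by
  have hsub : A \ blockedRows T c r s₀ ⊆
      (A \ blockedRows T c (mergeRows Mv r r') s₀) ∪ blockedRows (T ∩ Mv) c r' s₀ := by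
    intro i hi
    rw [Finset.mem_union, Finset.mem_sdiff]
    obtain ⟨hiA, hib⟩ := Finset.mem_sdiff.mp hi
    by_cases h2 : i ∈ blockedRows (T ∩ Mv) c r' s₀
    · exact Or.inr h2
    · refine Or.inl ⟨hiA, fun hi' => ?_⟩
      rcases Finset.mem_union.mp (blockedRows_merge_subset T Mv c r r' s₀ hi') with h | h
      · exact hib h
      · exact h2 h
  exact (Finset.card_le_card hsub).trans (Finset.card_union_le _ _)

/-! ## 3. One complete round -/

open scoped Classical in
/-- **ONE COMPLETE RE-PICK ROUND** on the round invariant (see the module docstring).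
[this file] -/
theorem round_advance (T : Finset (Fin 3 → Fin (qOf m))) (s₀ : Fin m)
    (r : (Fin 3 → Fin (qOf m)) → Fin m) (key : (Fin 3 → Fin (qOf m)) → ℕ) (hm : 0 < m)
    {M N n₀ : ℕ} {p₁ t B : ℝ}
    (A : (Fin 3 → Fin (qOf m)) → Finset (Fin m)) (hadm : ∀ c, r c ∈ A c)
    (hr : r ∉ phaseABad T M N n₀ p₁ t B)
    {n : ℝ} (hn : 0 < n)
    (hroom : ∀ c ∈ movers T s₀ r key, n ≤ (((A c) \ blockedRows T c r s₀).card : ℝ))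
    {p : ℝ} (hp0 : 0 < p) (hpm : 1 / (m : ℝ) ≤ p) (hpn : 1 / n ≤ p)
    {K : ℕ} (hK : (movers T s₀ r key).card ≤ K)
    {K' lam t₂ δ : ℝ} (hK' : 0 < K') (hlam : 0 < lam) (ht₂ : 0 < t₂) (hδ : 0 < δ)
    (hsmall : p ^ 2 * (2 * (K : ℝ) * K) / K' + K * eCol p (2 * K + 1) lam +
      (T.card : ℝ) * m * (eRow p (2 * K + 1) t₂ + eCol p (2 * K + 1) t₂ +
        eRow p (2 * K + 1) δ + eCol p (2 * K + 1) δ) < 1) :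
    ∃ r'' : (Fin 3 → Fin (qOf m)) → Fin m,
      (∀ c, r'' c ∈ A c) ∧
      r'' ∉ phaseABad T M N n₀ p₁ (t + (p * (2 * K + 1) + t₂)) (B - (p * (2 * K + 1) + δ)) ∧
      movers T s₀ r'' key ⊆ movers T s₀ r key ∧
      ((movers T s₀ r'' key).card : ℝ) < K' ∧
      (∀ c ∈ movers T s₀ r'' key,
        n - (p * (2 * K + 1) + lam) ≤ (((A c) \ blockedRows T c r'' s₀).card : ℝ)) ∧
      (∀ c, c ∉ movers T s₀ r key → r'' c = r c) := by
  set Mv := movers T s₀ r key with hMv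
  set A₂ : (Fin 3 → Fin (qOf m)) → Finset (Fin m) := fun c => (A c) \ blockedRows T c r s₀
    with hA₂
  have hA₂ne : ∀ c ∈ Mv, (A₂ c).Nonempty := fun c hc => by
    have h := hroom c hc
    have h' : (0 : ℝ) < (((A c) \ blockedRows T c r s₀).card : ℝ) := lt_of_lt_of_le hn h
    have h'' : 0 < ((A c) \ blockedRows T c r s₀).card := by exact_mod_cast h'
    simp only [hA₂]
    exact Finset.card_pos.mp h''
  have hAp : ∀ c ∈ Mv, 1 / ((A₂ c).card : ℝ) ≤ p := fun c hc => by
    simp only [hA₂]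
    exact (one_div_le_one_div_of_le hn (hroom c hc)).trans hpn
  obtain ⟨r', hr'A, hcoll, hblk, hrow, hcol, hfrow, hfcol⟩ :=
    exists_repick T s₀ r key hm A₂ hA₂ne hp0 hpm hAp hK
      (fun c i => lightCols T c M i) (fun c j => lightRows T c M j) hK' hlam ht₂ hδ hsmall
  have hr'A' : ∀ c ∈ Mv, r' c ∈ A c ∧ r' c ∉ blockedRows T c r s₀ := fun c hc => by
    have h := hr'A c hc
    simp only [hA₂, Finset.mem_sdiff] at h
    exact h
  have ha : ∀ c ∈ Mv, r' c ∉ blockedRows T c r s₀ := fun c hc => (hr'A' c hc).2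
  have hstep := round_step key ha
  refine ⟨mergeRows Mv r r', fun c => ?_, ?_, hstep.1, ?_, fun c hc => ?_, fun c hc =>
    mergeRows_of_not_mem hc⟩
  · by_cases hc : c ∈ Mv
    · rw [mergeRows_of_mem hc]; exact (hr'A' c hc).1
    · rw [mergeRows_of_not_mem hc]; exact hadm c
  · refine mergeRows_not_mem_phaseABad T Mv hr (fun c hc i => ?_) (fun c hc j => ?_)
      (fun c hc i => ?_) (fun c hc j => ?_)
    · have h := hrow c hc i
      beta_reduce at h
      exact h
    · have h := hcol c hc j
      beta_reduce at h
      exact h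
    · have h := hfrow c hc i
      simp only [rowKillOn_univ] at h
      exact h.le
    · have h := hfcol c hc j
      simp only [colKillOn_univ] at h
      exact h.le
  · have h := hstep.2.1
    calc ((movers T s₀ (mergeRows Mv r r') key).card : ℝ)
        ≤ (collCount (T ∩ Mv) s₀ r' : ℕ) := by exact_mod_cast h
      _ < K' := hcoll
  · have hcMv : c ∈ Mv := hstep.1 hc
    have hcT' : c ∈ T ∩ Mv := Finset.mem_inter.mpr ⟨(mem_movers.mp hc).1, hcMv⟩
    have hb := hblk c hcT'
    have hcard := card_room_merge_ge T Mv c (A c) r r' s₀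
    have hcardR : (((A c) \ blockedRows T c r s₀).card : ℝ) ≤
        (((A c) \ blockedRows T c (mergeRows Mv r r') s₀).card : ℝ) +
          ((blockedRows (T ∩ Mv) c r' s₀).card : ℝ) := by exact_mod_cast hcard
    have := hroom c hcMv
    linarith

end Summit.ValiantsHypothesis.ValiantsHypothesis.Theorems.DefinabilityGapRound
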